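import Literature.Algebra.Homology.LefschetzNumber
import Mathlib.Algebra.Homology.HomotopyCategory.ShiftSequence
import HarnessLib

/-!
# `Λ(φ⟦n⟧) = (−1)ⁿ·Λ(φ)` — the Lefschetz number under the shift of cochain complexes

Layer `Literature/Algebra/Homology` (pure linear algebra over Mathlib; proved theorems only, 0 definitions, 0 named facts,
no instances, no notation). The TRACE twin of row `EulerCharacteristicShift` (`χ(K⟦n⟧) = (−1)ⁿ χ(K)`) for row `LefschetzNumber`'s
`lefschetzNumber`: for a cochain complex `C` of vector spaces over a field `K`, an endomorphism `φ : C ⟶ C` and `n : ℤ`,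

* `finsum_negOnePow_smul_comp_add_right` — the sign re-indexing `Σᶠ p, (−1)ᵖ • g (p + n) = (−1)ⁿ • Σᶠ q, (−1)^q • g q`
  (ring-valued, no finiteness);
* `trace_homologyMap_shift` — `tr(Hᵖ(φ⟦n⟧)) = tr(Hᵖ⁺ⁿ(φ))`: `Hᵖ(φ⟦n⟧)` is conjugate to `Hᵖ⁺ⁿ(φ)` along Mathlib's natural
  isomorphism `CochainComplex.ShiftSequence.shiftIso` (the one row `EulerCharacteristicShift` uses for `dim`), `LinearMap.trace_conj'`;
* **`lefschetzNumber_shift : Λ(φ⟦n⟧') = (−1)ⁿ • Λ(φ)`** — NO finiteness hypothesis;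
* the chain-level shadow `finsum_negOnePow_smul_trace_f_shift` (`(φ⟦n⟧').f p = φ.f (p + n)` definitionally).

With `φ = 𝟙` this is row `EulerCharacteristicShift` (`tr 𝟙 = dim`), cited not restated. LEAF A of (E-16); LEAF B =
`LefschetzNumberMappingCone`. Library only (cell `pub-hodge-ring2`, count-neutral); proves nothing about any crux, route or conjecture.

## References

* A. Hatcher, *Algebraic Topology* (2002), §2.C (Lefschetz number). [HatcherAT2002]
* E. H. Spanier, *Algebraic Topology* (1981), Ch. 4 §7. [Spanier1981]
-/

open CategoryTheory CategoryTheory.Limits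

universe v u

namespace Literature.Algebra.Homology.Lefschetz

/-- **Sign re-indexing**: `Σᶠ p, (−1)ᵖ • g (p + n) = (−1)ⁿ • Σᶠ q, (−1)^q • g q` in a commutative ring without zero divisors (no finiteness:
both sides vanish together when the support is infinite). [cite: HatcherAT2002, §2.C] -/
theorem finsum_negOnePow_smul_comp_add_right {R : Type*} [CommRing R] [NoZeroDivisors R] (g : ℤ → R) (n : ℤ) :
    ∑ᶠ p : ℤ, (p.negOnePow : ℤ) • g (p + n) = (n.negOnePow : ℤ) • ∑ᶠ q : ℤ, (q.negOnePow : ℤ) • g q := by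
  conv_rhs => rw [← finsum_comp_equiv (Equiv.addRight n)]
  rw [zsmul_eq_mul, mul_finsum]
  refine finsum_congr fun p => ?_
  have h2 : ((n.negOnePow : ℤ) : R) * ((n.negOnePow : ℤ) : R) = 1 := by
    rw [← Int.cast_mul, ← Units.val_mul, Int.units_mul_self, Units.val_one, Int.cast_one]
  rw [Equiv.coe_addRight, zsmul_eq_mul, zsmul_eq_mul, Int.negOnePow_add, Units.val_mul, Int.cast_mul]
  linear_combination (-(((p.negOnePow : ℤ) : R) * g (p + n))) * h2

variable {K : Type u} [Field K] (C : CochainComplex (ModuleCat.{v} K) ℤ) (φ : C ⟶ C) (n : ℤ)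

/-- **`tr(Hᵖ(φ⟦n⟧)) = tr(Hᵖ⁺ⁿ(φ))`**: naturality of Mathlib's `ShiftSequence.shiftIso` conjugates `Hᵖ(φ⟦n⟧)` into `Hᵖ⁺ⁿ(φ)`.
No finiteness needed. [cite: HatcherAT2002, §2.C] -/
theorem trace_homologyMap_shift (p : ℤ) :
    LinearMap.trace K _ (HomologicalComplex.homologyMap ((shiftFunctor _ n).map φ) p).hom =
      LinearMap.trace K _ (HomologicalComplex.homologyMap φ (p + n)).hom := by
  let e : ((shiftFunctor _ n).obj C).homology p ≅ C.homology (p + n) :=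
    (CochainComplex.ShiftSequence.shiftIso (ModuleCat.{v} K) n p (p + n) (add_comm _ _)).app C
  have nat : HomologicalComplex.homologyMap ((shiftFunctor _ n).map φ) p ≫ e.hom =
      e.hom ≫ HomologicalComplex.homologyMap φ (p + n) :=
    (CochainComplex.ShiftSequence.shiftIso (ModuleCat.{v} K) n p (p + n) (add_comm _ _)).hom.naturality φ
  have hconj : (HomologicalComplex.homologyMap φ (p + n)).hom =
      e.toLinearEquiv.conj (HomologicalComplex.homologyMap ((shiftFunctor _ n).map φ) p).hom := by
    apply LinearMap.ext
    intro y
    obtain ⟨x, rfl⟩ := e.toLinearEquiv.surjective y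
    rw [LinearEquiv.conj_apply, LinearMap.comp_apply, LinearMap.comp_apply, LinearEquiv.coe_coe, LinearEquiv.coe_coe,
      LinearEquiv.symm_apply_apply, Iso.toLinearEquiv_apply, Iso.toLinearEquiv_apply]
    have hx := congrArg (fun g => g.hom x) nat
    simp only [ModuleCat.hom_comp, LinearMap.comp_apply] at hx
    exact hx.symm
  rw [hconj, LinearMap.trace_conj']

/-- **`Λ(φ⟦n⟧') = (−1)ⁿ • Λ(φ)`** for an endomorphism `φ` of a cochain complex of vector spaces — no finiteness hypothesis.
[cite: HatcherAT2002, §2.C] [cite: Spanier1981, Ch. 4 §7] -/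
theorem lefschetzNumber_shift :
    lefschetzNumber ((shiftFunctor _ n).map φ) = (n.negOnePow : ℤ) • lefschetzNumber φ := by
  simp only [lefschetzNumber, ComplexShape.χ, ComplexShape.eulerCharSignsUpInt_χ, trace_homologyMap_shift C φ n]
  exact finsum_negOnePow_smul_comp_add_right
    (fun q => LinearMap.trace K _ (HomologicalComplex.homologyMap φ q).hom) n

/-- Iterated shifts: `Λ((φ⟦n⟧')⟦m⟧') = (−1)ⁿ⁺ᵐ • Λ(φ)`. [cite: HatcherAT2002, §2.C] -/
theorem lefschetzNumber_shift_shift (m : ℤ) :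
    lefschetzNumber ((shiftFunctor _ m).map ((shiftFunctor _ n).map φ)) = ((n + m).negOnePow : ℤ) • lefschetzNumber φ := by
  rw [lefschetzNumber_shift, lefschetzNumber_shift, smul_smul, ← Units.val_mul, ← Int.negOnePow_add, add_comm]

/-- **Chain-level shadow**: `Σᶠ p, (−1)ᵖ • tr((φ⟦n⟧')ᵖ) = (−1)ⁿ • Σᶠ q, (−1)^q • tr(φ^q)` (the terms of `C⟦n⟧` and the
components of `φ⟦n⟧'` are those of `C`, `φ` re-indexed, definitionally). [cite: HatcherAT2002, Thm. 2C.3] -/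
theorem finsum_negOnePow_smul_trace_f_shift :
    ∑ᶠ p : ℤ, (p.negOnePow : ℤ) • LinearMap.trace K (((shiftFunctor _ n).obj C).X p) (((shiftFunctor _ n).map φ).f p).hom =
      (n.negOnePow : ℤ) • ∑ᶠ q : ℤ, (q.negOnePow : ℤ) • LinearMap.trace K (C.X q) (φ.f q).hom :=
  finsum_negOnePow_smul_comp_add_right (fun q => LinearMap.trace K (C.X q) (φ.f q).hom) n

end Literature.Algebra.Homology.Lefschetz
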